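import Summits.ResolutionOfSingularities.ResolutionOfSingularities.Theorems.EquisingularLiftEquisingularLiftNatTCPlusInvBaseS
import Summits.ResolutionOfSingularities.ResolutionOfSingularities.Theorems.EquisingularLiftEquisingularLiftNatSubchainSupplierInvSLDefs
import HarnessLib

/-!
# [OURS · L1 W4.5(b) · EL♮(3) · T23-A‴ (U6)] (S7′SL) B9 AT THE SEED FOR `INV := TCPlus.InvSL` — `inv_baseSL`: the seed of res-L1-w45b-lead-2's
# `InCarrierReachKSs` 0c6a341d172f5c17 carries NO later planes (`Ps₂ = []`, `Ms₂ = []`; res-L1-w45b-stub-4's ENGINE WORD v1.2 d02b1fbd6b6fb5d2: no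
# initial-stage letters in v1), so the base case is res-type-027's `inv_baseS` (…NatTCPlusInvBaseS p618345) with the empty plane list
# (`TCPlus.invSL_nil_of_invS`, p626460). One line; provided so that the V10⁗ assembly can cite a name.

res-type-027 g18 ((U6) owner), brick (F7). OURS; NOT a statement of any manuscript ([Hironaka2017] is a candidate under adjudication, nothing of
it is asserted); AI-written, weaker than expert review. No `sorry`; standard axioms; DEF-FREE; `--supports stmt-ResolutionOfSingularities-20148 --as helper`.
[cite: GortzWedhorn2020, Prop. 13.91] [cite: Liu2002, Thm. 8.1.19] [cite: Matsumura1987, Thm. 14.2]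
-/

set_option linter.dupNamespace false -- mandated namespace `Summit.<Summit>.<Problem>` of this single-conjunct summit
set_option linter.overlappingInstances false -- the binders carry `[IsDomain O] [IsDiscreteValuationRing O]`

noncomputable section

open CategoryTheory CategoryTheory.Limits AlgebraicGeometry TopologicalSpace IsLocalRing
open Literature.AlgebraicGeometry.Resolution
open AlgebraicGeometry.Scheme.IdealSheafData
open Summit.ResolutionOfSingularities.ResolutionOfSingularities.Cruxes.EquisingularLift.StrataSplit

namespace Summit.ResolutionOfSingularities.ResolutionOfSingularities.Cruxes.EquisingularLiftNat.Sections

/-- **(S7′SL) `TCPlus.InvSL` at the seed, empty plane list** (= `inv_baseS` + `TCPlus.invSL_nil_of_invS`). [cite: GortzWedhorn2020, Prop. 13.91]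
[OURS · L1 W4.5b · T23-A‴ (U6)] brick (F7) (stmt-ResolutionOfSingularities-20148); NOT a statement of the manuscript. -/
theorem inv_baseSL (p : ℕ) [Fact p.Prime] (k : Type) [Field k] [CharP k p] [IsAlgClosed k] (O : Type) [CommRing O] [IsDomain O]
    [IsDiscreteValuationRing O] [IsAdicComplete (IsLocalRing.maximalIdeal O) O] [IsAlgClosed (IsLocalRing.ResidueField O)]
    (θ : O →+* k) (hθ : Function.Surjective θ) (P : Scheme.{0}) (q : P ⟶ Spec (.of O)) (Y : Set P)
    (Ch : ∀ X' : Scheme.{0}, (X' ⟶ P) → Set X' → Prop)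
    (hChSplit : ∀ (X' : Scheme.{0}) (σ' : X' ⟶ P) (S' : Set X'), Ch X' σ' S' →
      Summit.ResolutionOfSingularities.ResolutionOfSingularities.Theses.EquisingularLift.Split.Chain P Y X' σ' S')
    (hPnoeth : IsLocallyNoetherian P) (hPreg : Scheme.IsRegular P) [IsProper q]
    (X' : Scheme.{0}) (σ' : X' ⟶ P) (S' : Set X') (hCh' : Ch X' σ' S') [IsIntegral X'] [IsLocallyNoetherian X']
    (hX'reg : Scheme.IsRegular X') (F₁ : Scheme.{0}) [IsIntegral F₁] (j : F₁ ⟶ X') (t : F₁ ⟶ Spec (.of k))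
    (hsq : IsPullback j t (σ' ≫ q) (Spec.map (CommRingCat.ofHom θ))) (T₁ : Set F₁) (x : F₁) (hx : IsClosed ({x} : Set F₁))
    (hxreg : IsRegularLocalRing (F₁.presheaf.stalk x))
    (U : X'.Opens) (hU : Smooth (U.ι ≫ σ' ≫ q)) (s : Spec (.of O) ⟶ X') (hs : s ≫ σ' ≫ q = 𝟙 _)
    (hsU : s (IsLocalRing.closedPoint O) ∈ U) (hsx : s (IsLocalRing.closedPoint O) = j x)
    (hdim : ringKrullDim (X'.presheaf.stalk (s (IsLocalRing.closedPoint O))) = ((3 + 1 : ℕ) : WithBot ℕ∞))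
    (hsoff : ∀ c ∈ (s.ker.support : Set X'), ¬ IsGenericPoint (σ' c) Y)
    (X₁ : Scheme.{0}) (τ₁ : X₁ ⟶ X') (hτ₁ : IsBlowup τ₁ s.ker) [IsIntegral X₁] [IsLocallyNoetherian X₁]
    (hX₁reg : Scheme.IsRegular X₁) (hX₁dom : IsDominant ((τ₁ ≫ σ') ≫ q))
    (F₂ : Scheme.{0}) [IsIntegral F₂] (υ : F₂ ⟶ F₁) (hυ : IsBlowup υ (vanishingIdeal (⟨{x}, hx⟩ : Closeds F₁)))
    (j₂ : F₂ ⟶ X₁) (t₂ : F₂ ⟶ Spec (.of k)) (hsq₂ : IsPullback j₂ t₂ ((τ₁ ≫ σ') ≫ q) (Spec.map (CommRingCat.ofHom θ)))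
    (hcomm : j₂ ≫ τ₁ = υ ≫ j) (hcarrier : (s.ker.comap τ₁).comap j₂ = (vanishingIdeal (⟨{x}, hx⟩ : Closeds F₁)).comap υ)
    (hCh₁ : Ch X₁ (τ₁ ≫ σ') (j₂ '' closure (υ ⁻¹' (T₁ \ {x}))))
    (hirr₂ : IsIrreducible (closure (υ ⁻¹' (T₁ \ {x}))))
    (W : Set F₁) (hnot : ¬ (υ ⁻¹' {x} ⊆ closure (υ ⁻¹' (W \ {x})))) (hcone : ConeForm F₁ x W) :
    TCPlus.InvSL O k θ P q Y Ch W F₂ (𝟙 F₂) (closure (υ ⁻¹' (T₁ \ {x}))) (υ ⁻¹' {x} ∩ closure (υ ⁻¹' (W \ {x})))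
      (closure (υ ⁻¹' (W \ {x}))) (υ ⁻¹' {x}) [] false :=
  TCPlus.invSL_nil_of_invS O k θ P q Y Ch
    (inv_baseS p k O θ hθ P q Y Ch hChSplit hPnoeth hPreg X' σ' S' hCh' hX'reg F₁ j t hsq T₁ x hx hxreg U hU s hs hsU hsx hdim hsoff X₁ τ₁ hτ₁
      hX₁reg hX₁dom F₂ υ hυ j₂ t₂ hsq₂ hcomm hcarrier hCh₁ hirr₂ W hnot hcone)

end Summit.ResolutionOfSingularities.ResolutionOfSingularities.Cruxes.EquisingularLiftNat.Sections

end
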